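import Summits.KontsevichZagierPeriods.KontsevichZagierPeriods.Theorems.SoloBlindFermatCubic
import Summits.KontsevichZagierPeriods.KontsevichZagierPeriods.Theorems.SoloBlindBoxRankOne
import HarnessLib

/-!
# Monomial regions: `{yⁿ ≤ xᵐ}` is KZ-equivalent to the point cell `n/(m+n)`

For natural numbers `m` and `n = k+1 ≥ 1`, the region under the algebraic curve `y = x^{m/n}`,

  `P_{m,n} = {(x,y) | 0 < x < 1, 0 ≤ y, yⁿ ≤ xᵐ}`   (area `n/(m+n)`),

is `ℚ`-rational with a CURVED boundary, yet three KZ moves straighten it: Newton–Leibniz to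
`[(0,1), x^{m/n} dx]`, then the polynomial chart `x = uⁿ` (`x^{m/n} dx = n u^{m+n-1} du`) to the
`ℚ`-RATIONAL representation `[(0,1), n u^{m+n-1} du]`, whose class is `(n/(m+n))•1` by the cell
calculus.  Hence **`[P_{m,n}] = (n/(m+n))•1`** (`mkQ_powRegion`) and **`P_{m,n} ≡ K(n/(m+n))`**,
the point cell (`kz_powRegion_constCell`): a scissors-type statement for curved regions, inside
the rules.  The Kontsevich–Zagier conjecture holds for `P_{m,n}` against every class of the cell
span (`kz_powRegion`).

References: Kontsevich–Zagier, *Periods* (2001), §1.1–1.2. -/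

noncomputable section

namespace Summit.KontsevichZagierPeriods.KontsevichZagierPeriods.Theorems

open Set MeasureTheory
open Literature.ModelTheory.ExponentialFields (IsSemialgebraic)
open MvPolynomial (aeval X C)
open Literature.NumberTheory.Transcendental
open Literature.NumberTheory.Transcendental.KZ

namespace SoloBlind

variable (m k : ℕ)

/-- The exponent `m/n`, `n = k+1`, as a rational number. -/
def powExp : ℚ := (m : ℚ) / (k + 1)

/-- `0 ≤ m/n`. -/
theorem powExp_nonneg : (0:ℝ) ≤ ((powExp m k : ℚ) : ℝ) := by
  rw [powExp]; push_cast; positivity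

/-- `(m/n)·n = m` in `ℝ`. -/
theorem powExp_mul : ((powExp m k : ℚ) : ℝ) * ((k:ℝ) + 1) = m := by
  rw [powExp]; push_cast; field_simp

/-- `β(x) = x^{m/n}`. -/
def powF (x : ℝ) : ℝ := x ^ (((powExp m k : ℚ)) : ℝ)

/-- `0 ≤ β(x)` for `x ≥ 0`. -/
theorem powF_nonneg {x : ℝ} (hx : 0 ≤ x) : 0 ≤ powF m k x := Real.rpow_nonneg hx _

/-- `β(x)ⁿ = xᵐ` for `x ≥ 0`. -/
theorem powF_pow {x : ℝ} (hx : 0 ≤ x) : powF m k x ^ (k + 1) = x ^ m := by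
  rw [powF, ← Real.rpow_natCast, ← Real.rpow_mul hx, Nat.cast_succ, powExp_mul, Real.rpow_natCast]

/-- `β(uⁿ) = uᵐ` for `u ≥ 0`. -/
theorem powF_pow' {u : ℝ} (hu : 0 ≤ u) : powF m k (u ^ (k + 1)) = u ^ m := by
  rw [powF, ← Real.rpow_natCast u (k + 1), ← Real.rpow_mul hu, Nat.cast_succ, mul_comm,
    powExp_mul, Real.rpow_natCast]

/-- `β` is continuous. -/
theorem continuous_powF : Continuous (powF m k) := Real.continuous_rpow_const (powExp_nonneg m k)

/-- `β` is integrable on `(0,1)`. -/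
theorem integrableOn_powF : IntegrableOn (powF m k) (Ioo 0 1) :=
  ((continuous_powF m k).continuousOn.integrableOn_Icc (μ := volume)).mono_set Ioo_subset_Icc_self

/-- `β` is `ℚ`-semialgebraic on `(0,1)` (an Euler–Mellin integrand). -/
theorem isSemialgebraicFunOn_powF :
    IsSemialgebraicFunOn ℚ (line (Ioo 0 1)) (fun x : Fin 1 → ℝ => powF m k (x 0)) := by
  have h := isSemialgebraicFunOn_mellinIntegrand
    (isSemialgebraic_line_Ioo isAlgebraic_zero isAlgebraic_one)
    ![(X 0 : MvPolynomial (Fin 1) ℚ)] ![powExp m k] 1 (fun x hx k => by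
      have hx0 : 0 < x 0 := (mem_line.mp hx).1
      simpa using hx0)
  refine h.congr fun x _ => ?_
  simp only [mellinIntegrand_apply, Fin.prod_univ_one, Matrix.cons_val_fin_one, MvPolynomial.aeval_X,
    powF]
  push_cast
  ring

/-- **`[(0,1), x^{m/n} dx]`.** -/
def pow1 : IntegralRep 1 :=
  lineRep (Ioo 0 1) (powF m k) (isSemialgebraic_line_Ioo isAlgebraic_zero isAlgebraic_one)
    (isSemialgebraicFunOn_powF m k) (integrableOn_powF m k)

/-! ## The region `P_{m,n}` -/

/-- `P_{m,n} = {0 < x < 1, 0 ≤ y, yⁿ ≤ xᵐ}`. -/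
def kzPow : Set (Fin 2 → ℝ) := {z | (0 < z 0 ∧ z 0 < 1) ∧ 0 ≤ z 1 ∧ z 1 ^ (k + 1) ≤ z 0 ^ m}

/-- `P_{m,n}` is `ℚ`-semialgebraic. -/
theorem isSemialgebraic_kzPow : IsSemialgebraic ℚ (kzPow m k) := by
  convert isSemialgebraic_subgraph (X 1 ^ (k + 1)) (X 0 ^ m) using 1
  ext z
  simp [kzPow]

/-- `P_{m,n}` is the region under the graph of `β`. -/
theorem kzPow_eq : kzPow m k = {z | (0 < z 0 ∧ z 0 < 1) ∧ 0 ≤ z 1 ∧ z 1 ≤ powF m k (z 0)} := by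
  ext z
  simp only [kzPow, mem_setOf_eq]
  refine and_congr_right fun hx => and_congr_right fun hy => ?_
  rw [← pow_le_pow_iff_left₀ hy (powF_nonneg m k hx.1.le) k.succ_ne_zero, powF_pow m k hx.1.le]

/-- `P_{m,n}` lies in the unit square. -/
theorem kzPow_subset : kzPow m k ⊆ Icc 0 1 := subset_Icc_of_le_one fun z hz => by
  obtain ⟨hx, hy, h⟩ := hz
  refine ⟨hx, hy, ?_⟩
  have h1 : z 1 ^ (k + 1) ≤ 1 := h.trans (pow_le_one₀ hx.1.le hx.2.le)
  exact (pow_le_one_iff_of_nonneg hy k.succ_ne_zero).mp h1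

/-- **`P_{m,n} = [{0<x<1, 0≤y, yⁿ≤xᵐ}, 1]`**, with `ℚ`-rational data. -/
def powRegion : IntegralRep 2 :=
  ratRep (kzPow m k) (fun _ => 1) 1 1 (isSemialgebraic_kzPow m k) (fun _ _ => by simp)
    (fun _ _ => by simp) (integrableOn_one_of_subset_Icc (kzPow_subset m k))

/-- `P_{m,n}` has KZ's literal rational shape. -/
theorem isRational_powRegion : (powRegion m k).IsRational := isRational_ratRep

/-- **Move (Newton–Leibniz): `P_{m,n} ≡ [(0,1), x^{m/n} dx]`.** -/
theorem powRegion_sub_pow1 : of (powRegion m k) - of (pow1 m k) ∈ relations :=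
  subgraph_sub_lineRep (powRegion m k) (fun _ hx => powF_nonneg m k hx.1.le) (kzPow_eq m k) rfl

/-! ## The rational representation `[(0,1), n u^{m+n-1} du]` and the chart `x = uⁿ` -/

/-- `g(u) = n u^{m+n-1}`. -/
def monoF (u : ℝ) : ℝ := ((k:ℝ) + 1) * u ^ (m + k)

/-- `g` is `ℚ`-semialgebraic on `(0,1)` (a polynomial). -/
theorem isSemialgebraicFunOn_monoF :
    IsSemialgebraicFunOn ℚ (line (Ioo 0 1)) (fun x : Fin 1 → ℝ => monoF m k (x 0)) :=
  (isSemialgebraicFunOn_aeval (isSemialgebraic_line_Ioo isAlgebraic_zero isAlgebraic_one)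
    (C ((k:ℚ) + 1) * X 0 ^ (m + k) : MvPolynomial (Fin 1) ℚ)).congr fun x _ => by
      simp [monoF]

/-- **`[(0,1), n u^{m+n-1} du]`.** -/
def mono1 : IntegralRep 1 :=
  lineRep (Ioo 0 1) (monoF m k) (isSemialgebraic_line_Ioo isAlgebraic_zero isAlgebraic_one)
    (isSemialgebraicFunOn_monoF m k)
    ((((continuous_const.mul (continuous_pow (m + k))).continuousOn.integrableOn_Icc
      (μ := volume)).mono_set Ioo_subset_Icc_self))

/-- `[(0,1), n u^{m+n-1} du]` has KZ's literal rational shape. -/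
theorem isRational_mono1 : (mono1 m k).IsRational := by
  refine ⟨C ((k:ℚ) + 1) * X 0 ^ (m + k), 1, fun x _ => by simp, fun x _ => ?_⟩
  show monoF m k (x 0) = _
  simp [monoF]

/-- `u ↦ uⁿ` is `ℚ`-semialgebraic on `(0,1)`. -/
theorem isSemialgebraicFunOn_pow_succ :
    IsSemialgebraicFunOn ℚ (line (Ioo 0 1)) (fun x : Fin 1 → ℝ => x 0 ^ (k + 1)) :=
  (isSemialgebraicFunOn_aeval (isSemialgebraic_line_Ioo isAlgebraic_zero isAlgebraic_one)
    (X 0 ^ (k + 1) : MvPolynomial (Fin 1) ℚ)).congr fun x _ => by simp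

/-- `u ↦ uⁿ` is injective on `(0,1)`. -/
theorem injOn_pow_succ : InjOn (fun x : ℝ => x ^ (k + 1)) (Ioo 0 1) := fun _ hx _ hy h =>
  (pow_left_inj₀ hx.1.le hy.1.le k.succ_ne_zero).mp h

/-- `u ↦ uⁿ` maps `(0,1)` onto `(0,1)`. -/
theorem image_pow_succ : Ioo (0:ℝ) 1 = (fun x : ℝ => x ^ (k + 1)) '' Ioo 0 1 := by
  ext t
  constructor
  · rintro ⟨h0, h1⟩
    have hk : (0:ℝ) < (k:ℝ) + 1 := by positivity
    refine ⟨t ^ (1 / ((k:ℝ) + 1)), ⟨Real.rpow_pos_of_pos h0 _,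
      Real.rpow_lt_one h0.le h1 (by positivity)⟩, ?_⟩
    show (t ^ (1 / ((k:ℝ) + 1))) ^ (k + 1) = t
    rw [← Real.rpow_natCast, ← Real.rpow_mul h0.le, Nat.cast_succ, one_div_mul_cancel hk.ne',
      Real.rpow_one]
  · rintro ⟨x, hx, rfl⟩
    exact ⟨pow_pos hx.1 _, pow_lt_one₀ hx.1.le hx.2 k.succ_ne_zero⟩

/-- Pull-back: `β(uⁿ)·|n u^{n-1}| = g(u)`. -/
theorem powF_pullback {u : ℝ} (hu : u ∈ Ioo (0:ℝ) 1) :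
    monoF m k u = powF m k (u ^ (k + 1)) * |((k:ℕ) + 1 : ℝ) * u ^ k| := by
  rw [powF_pow' m k hu.1.le, abs_of_nonneg (by have := hu.1.le; positivity), monoF, pow_add]
  ring

/-- **Move (`x = uⁿ`): `[(0,1), n u^{m+n-1} du] ≡ [(0,1), x^{m/n} dx]`.** -/
theorem mono1_sub_pow1 : of (mono1 m k) - of (pow1 m k) ∈ relations := by
  unfold mono1 pow1
  exact lineRep_subst (fun x : ℝ => x ^ (k + 1)) (fun t => ((k:ℕ) + 1 : ℝ) * t ^ k)
    (isSemialgebraicFunOn_pow_succ k)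
    (fun t _ => by simpa using (hasDerivAt_pow (k + 1) t).hasDerivWithinAt) (injOn_pow_succ k)
    (image_pow_succ k) (fun t ht => powF_pullback m k ht)

/-! ## The class of `P_{m,n}` -/

/-- `∫₀¹ n u^{m+n-1} du = n/(m+n)`. -/
theorem mono1_value : (mono1 m k).value = ((k:ℝ) + 1) / (m + k + 1) := by
  rw [mono1, value_lineRep, ← integral_Ioc_eq_integral_Ioo,
    ← intervalIntegral.integral_of_le zero_le_one]
  simp only [monoF, intervalIntegral.integral_const_mul, integral_pow]
  push_cast
  simp [div_eq_mul_inv]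

/-- **`[P_{m,n}] = [(0,1), n u^{m+n-1} du]`** in `Q`: two moves. -/
theorem mkQ_powRegion_eq_mono1 : mkQ (of (powRegion m k)) = mkQ (of (mono1 m k)) := by
  rw [mkQ_eq_mkQ_iff, ← sub_sub_sub_cancel_right _ _ (of (pow1 m k))]
  exact relations.sub_mem (powRegion_sub_pow1 m k) (mono1_sub_pow1 m k)

/-- `P_{m,n}` lies in the cell span `V`. -/
theorem mkQ_powRegion_mem_cellSpan : mkQ (of (powRegion m k)) ∈ cellSpan := by
  rw [mkQ_powRegion_eq_mono1]
  exact mkQ_of_mem_cellSpan _ le_rfl (isRational_mono1 m k)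

/-- **`area(P_{m,n}) = n/(m+n)`**, read off from the moves. -/
theorem powRegion_value : (powRegion m k).value = ((k:ℝ) + 1) / (m + k + 1) := by
  rw [← mono1_value]
  exact Equivalent.value_eq_holds (mkQ_eq_mkQ_iff.mp (mkQ_powRegion_eq_mono1 m k))

/-- The area as an element of `K₀`. -/
def powArea : K₀ := (((k:ℚ) + 1) / (m + k + 1) : ℚ)

/-- The coercion of `powArea`. -/
theorem coe_powArea : ((powArea m k : K₀) : ℝ) = ((k:ℝ) + 1) / (m + k + 1) := by
  rw [powArea, coe_ratCast_K₀]
  push_cast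
  ring

/-- `n/(m+n)` is algebraic. -/
theorem isAlgebraic_powArea : IsAlgebraic ℚ (((k:ℝ) + 1) / (m + k + 1)) := by
  have h := mem_K₀_iff.mp (powArea m k).2
  rwa [coe_powArea] at h

/-- **`[P_{m,n}] = (n/(m+n))•1`** in `Q` (cell span injectivity). -/
theorem mkQ_powRegion : mkQ (of (powRegion m k)) = powArea m k • (1 : Q) := by
  have hmem : mkQ (of (powRegion m k)) - powArea m k • (1 : Q) ∈ cellSpan :=
    sub_mem (mkQ_powRegion_mem_cellSpan m k) (Submodule.smul_mem _ _ one_mem_cellSpan)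
  refine sub_eq_zero.mp (eq_zero_of_mem_cellSpan hmem ?_)
  rw [map_sub, evalQ_mkQ, eval_of, powRegion_value, evalQ_smul, map_one, mul_one, coe_powArea,
    sub_self]

/-- **`P_{m,n} ≡ K(n/(m+n))`**: the curved region `{yⁿ ≤ xᵐ}` and the rational point cell of the
same volume are equivalent under the Kontsevich–Zagier moves. -/
theorem kz_powRegion_constCell :
    Equivalent (powRegion m k)
      (constCell (((k:ℝ) + 1) / (m + k + 1)) (isAlgebraic_powArea m k)) := by
  rw [Equivalent, ← mkQ_eq_mkQ_iff, mkQ_powRegion, mkQ_constCell]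
  congr 1
  exact Subtype.ext (coe_powArea m k)

/-- **The Kontsevich–Zagier conjecture for `P_{m,n}`** against every representation with class
in `V`. -/
theorem kz_powRegion {d : ℕ} (r' : IntegralRep d) (hr' : mkQ (of r') ∈ cellSpan)
    (hv : (powRegion m k).value = r'.value) : Equivalent (powRegion m k) r' := by
  rw [Equivalent, ← mkQ_eq_mkQ_iff, ← sub_eq_zero]
  exact eq_zero_of_mem_cellSpan (sub_mem (mkQ_powRegion_mem_cellSpan m k) hr')
    (by rw [map_sub, evalQ_mkQ, evalQ_mkQ, eval_of, eval_of, hv, sub_self])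

end SoloBlind

end Summit.KontsevichZagierPeriods.KontsevichZagierPeriods.Theorems
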